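import Summits.QuantumFields.QCD.Theses.HeatSlicedQuarks
import Summits.QuantumFields.QCD.Theorems.HeatSlicedQuarksInterleavedHeatSliceFlowCollapse
import Summits.QuantumFields.QCD.Theorems.HeatSlicedQuarksQuarkSliceStability
import Summits.QuantumFields.QCD.Theorems.RobustYangMillsHandover.Negative.GapClauses

/-!
# `InterleavedFlowProper` (crux stmt-QuantumFields-18031, route HeatSlicedQuarks): logical anatomy of
# the glue — what a disproof must deliver, which hypotheses are load-bearing (negative-side support,
# cdisprove seat)

The crux is the glue `TracedQuadraticParametrix → QuarkLoopCoefficient → InterleavedHeatSliceFlow`, and the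
parent glue `InterleavedHeatSliceFlow := SmallFieldUltracontractivity → ActionBoundsLowModes →
ContinuumQCDExists` has collapsed onto the route target X₀ (`interleavedHeatSliceFlow_iff_continuumQCDExists`,
both engine cruxes 8871/8872 being theorems).  Proved here, sorry-free, pure logic over tree theorems:

* `not_interleavedFlowProper_iff` — `¬ glue ↔ TQP ∧ QLC ∧ ¬ X₀`: any refutation of this item must PROVE
  both lattice milestones (items 17985, 16786) AND REFUTE continuum QCD; `not_QCD_of_not_interleavedFlowProper`
  — it would refute the summit conjunct `QCD` as stated.
* `interleavedFlowProper_iff_continuumQCDExists` — modulo the two milestones the glue IS X₀ (no logical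
  discount; the planner declares it X₀-hard);  `interleavedFlowProper_iff_retired` — the rev-7 restatement
  (17988 → 18031: the hypothesis `QuarkSliceStability` was dropped) is logically idle, that support being a
  theorem (`QuarkSliceStability_proof`).
* load-bearing analysis: the variants with a milestone dropped (written inline) are
  consequences of X₀, so a `_false_without_` theorem for either would be a disproof of X₀
  (`not_continuumQCDExists_of_not_withoutTQP/QLC`); `interleavedFlowProper_or` — either a milestone is
  false (then the glue is vacuous) or the glue is equivalent to X₀; given `¬ X₀`, the glue holds iff a
  milestone is false (`interleavedFlowProper_iff_milestone_false_of_not_continuumQCDExists`).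
* `not_threshold_of_not_interleavedFlowProper` — the consequent is OFFSET-BLIND (tree
  `continuumQCDExists_iff_threshold`: X₀ ≡ massive QCD for all splittings above an unpinned common offset
  `M₀ ≥ 0`), so a refutation must kill even that heavy-threshold form; the glue never has to reach the
  chiral regime.

None of these refutes the crux; they fence it (see the crux work file
`Summits/QuantumFields/QCD/Cruxes/InterleavedFlowProper/Disproof.lean` for the attacks on the two
milestones — the only cheap closures — and why they resist).  No definitions, no named facts: every
variant of the glue is written inline.
-/

namespace Summit.QuantumFields.QCD.Theorems.InterleavedFlowProper.Negative

open Summit.QuantumFields.QCD.Theses.HeatSlicedQuarks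
open Summit.QuantumFields.QCD.Cruxes.InterleavedHeatSliceFlow
  (interleavedHeatSliceFlow_iff_continuumQCDExists)
open Literature.MathematicalPhysics.QuantumFieldTheory

/-! ## What a disproof must deliver -/

/-- **Content of the glue**: it is equivalent to "the two milestones imply the route target X₀"
(the parent glue has collapsed onto X₀, items 8871/8872 being theorems). -/
theorem interleavedFlowProper_iff_target_form :
    InterleavedFlowProper ↔
      (TracedQuadraticParametrix → QuarkLoopCoefficient → ContinuumQCDExists) :=
  ⟨fun h h1 h2 => interleavedHeatSliceFlow_iff_continuumQCDExists.mp (h h1 h2),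
    fun h h1 h2 => interleavedHeatSliceFlow_iff_continuumQCDExists.mpr (h h1 h2)⟩

/-- **What a refutation of item 18031 must deliver**: both lattice milestones proved AND X₀ refuted. -/
theorem not_interleavedFlowProper_iff :
    ¬ InterleavedFlowProper ↔
      (TracedQuadraticParametrix ∧ QuarkLoopCoefficient ∧ ¬ ContinuumQCDExists) := by
  rw [interleavedFlowProper_iff_target_form]
  constructor
  · intro h
    by_contra hc
    apply h
    intro h1 h2
    by_contra hX
    exact hc ⟨h1, h2, hX⟩
  · rintro ⟨h1, h2, hX⟩ h
    exact hX (h h1 h2)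

/-- Any disproof of the glue is a disproof of the route target X₀ = `ContinuumQCDExists`. -/
theorem not_continuumQCDExists_of_not_interleavedFlowProper (h : ¬ InterleavedFlowProper) :
    ¬ ContinuumQCDExists :=
  (not_interleavedFlowProper_iff.mp h).2.2

/-- **A disproof of the glue would refute the summit conjunct `QCD` as stated** (`QCD = QCDOf 2 ∧ QCDOf 3`
implies X₀: drop the chirality and gap clauses). -/
theorem not_QCD_of_not_interleavedFlowProper (h : ¬ InterleavedFlowProper) : ¬ _root_.QCD := by
  intro hQ
  apply not_continuumQCDExists_of_not_interleavedFlowProper h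
  intro Nf hNf
  have key : ∀ N : ℕ, QCDOf N → ∃ reg : QCDRegularisation N, reg.HasMassScaling ∧
      ∀ m : Fin N → ℝ, (∀ f, 0 < m f) → ∃ (z shift : QCDField N → ℕ → ℝ)
        (T : OSData (QCDField N) 4), IsQCDAlong (reg.scheme m z shift) T ∧
          T.IsNontrivial QCDField.glue ∧ T.IsNonGaussian QCDField.glue ∧
            ∀ f g : Fin N, f ≠ g → T.IsNontrivial (QCDField.pseudoRe f g) := by
    rintro N ⟨reg, hms, -, hall⟩
    refine ⟨reg, hms, fun m hm => ?_⟩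
    obtain ⟨z, shift, T, hA, hN, hG, hP, -⟩ := hall m hm
    exact ⟨z, shift, T, hA, hN, hG, hP⟩
  rcases hNf with rfl | rfl
  · exact key 2 hQ.1
  · exact key 3 hQ.2

/-- Given the two milestones, the glue IS the target: they give no logical discount. -/
theorem interleavedFlowProper_iff_continuumQCDExists
    (h1 : TracedQuadraticParametrix) (h2 : QuarkLoopCoefficient) :
    InterleavedFlowProper ↔ ContinuumQCDExists :=
  ⟨fun h => interleavedHeatSliceFlow_iff_continuumQCDExists.mp (h h1 h2),
    fun hX _ _ => interleavedHeatSliceFlow_iff_continuumQCDExists.mpr hX⟩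

/-- **The rev-7 restatement is logically idle**: `QuarkSliceStability` is a theorem
(`QuarkSliceStability_proof`), so the retired typing of the glue (item 17988, route rev ≤ 6:
`TQP → QLC → QuarkSliceStability → InterleavedHeatSliceFlow`) and the current typing 18031 coincide. -/
theorem interleavedFlowProper_iff_retired :
    InterleavedFlowProper ↔
      (TracedQuadraticParametrix → QuarkLoopCoefficient → QuarkSliceStability →
        InterleavedHeatSliceFlow) :=
  ⟨fun h h1 h2 _ => h h1 h2,
    fun h h1 h2 => h h1 h2 Theorems.HeatSlicedQuarks.QuarkSliceStability_proof⟩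

/-! ## Load-bearing analysis: a milestone dropped -/

/-- OBSTRUCTION: the glue with `TracedQuadraticParametrix` DROPPED (`QLC → InterleavedHeatSliceFlow`) is a
consequence of X₀, so a `_false_without_TQP` theorem would disprove continuum QCD. -/
theorem not_continuumQCDExists_of_not_withoutTQP
    (h : ¬ (QuarkLoopCoefficient → InterleavedHeatSliceFlow)) : ¬ ContinuumQCDExists :=
  fun hX => h fun _ => interleavedHeatSliceFlow_iff_continuumQCDExists.mpr hX

/-- OBSTRUCTION: the glue with `QuarkLoopCoefficient` DROPPED (`TQP → InterleavedHeatSliceFlow`) is a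
consequence of X₀, so a `_false_without_QLC` theorem would disprove continuum QCD. -/
theorem not_continuumQCDExists_of_not_withoutQLC
    (h : ¬ (TracedQuadraticParametrix → InterleavedHeatSliceFlow)) : ¬ ContinuumQCDExists :=
  fun hX => h fun _ => interleavedHeatSliceFlow_iff_continuumQCDExists.mpr hX

/-- The dropped-milestone variants are sandwiched, `X₀ → (glue without H) → glue`, and modulo the two
milestones both are equivalent to X₀. -/
theorem withoutTQP_iff_and_withoutQLC_iff
    (h1 : TracedQuadraticParametrix) (h2 : QuarkLoopCoefficient) :
    ((QuarkLoopCoefficient → InterleavedHeatSliceFlow) ↔ ContinuumQCDExists) ∧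
      ((TracedQuadraticParametrix → InterleavedHeatSliceFlow) ↔ ContinuumQCDExists) :=
  ⟨⟨fun h => interleavedHeatSliceFlow_iff_continuumQCDExists.mp (h h2),
      fun hX _ => interleavedHeatSliceFlow_iff_continuumQCDExists.mpr hX⟩,
    ⟨fun h => interleavedHeatSliceFlow_iff_continuumQCDExists.mp (h h1),
      fun hX _ => interleavedHeatSliceFlow_iff_continuumQCDExists.mpr hX⟩⟩

/-- **Trichotomy**: a milestone is false (and then the glue is vacuously provable), or the glue is
literally equivalent to X₀. -/
theorem interleavedFlowProper_or :
    (¬ TracedQuadraticParametrix ∨ ¬ QuarkLoopCoefficient) ∨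
      (InterleavedFlowProper ↔ ContinuumQCDExists) := by
  by_cases h1 : TracedQuadraticParametrix
  · by_cases h2 : QuarkLoopCoefficient
    · exact Or.inr (interleavedFlowProper_iff_continuumQCDExists h1 h2)
    · exact Or.inl (Or.inr h2)
  · exact Or.inl (Or.inl h1)

/-- The exact sense of the route note "trivial again if 17985/16786 false": were X₀ false, the glue would
hold iff a milestone is false. -/
theorem interleavedFlowProper_iff_milestone_false_of_not_continuumQCDExists (hX : ¬ ContinuumQCDExists) :
    InterleavedFlowProper ↔ (¬ TracedQuadraticParametrix ∨ ¬ QuarkLoopCoefficient) := by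
  rw [interleavedFlowProper_iff_target_form]
  constructor
  · intro h
    by_contra hc
    push Not at hc
    exact hX (h hc.1 hc.2)
  · rintro (h | h) h1 h2
    · exact absurd h1 h
    · exact absurd h2 h

/-! ## The consequent is offset-blind -/

/-- X₀ is offset-blind (tree `RobustYangMillsHandover.Negative.continuumQCDExists_iff_threshold`: re-base
`m_crit(k) ↦ m_crit(k) + a_k M₀ / Z_m(k)`), hence a refutation of the glue must refute even the
heavy-threshold form of X₀: for some `N_f ∈ {2, 3}`, for EVERY offset `M₀ ≥ 0` and every regularisation
with mass scaling, some mass tuple above `M₀` admits no non-trivial QCD data along the scheme. The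
consequent of the glue never reaches the chiral regime (the summit's `QCDOf` adds `IsChiralAtZero` and the
gap clauses; X₀ has neither, by design of the route). -/
theorem not_threshold_of_not_interleavedFlowProper (h : ¬ InterleavedFlowProper) :
    ¬ ∀ Nf : ℕ, Nf = 2 ∨ Nf = 3 → ∃ M₀ : ℝ, 0 ≤ M₀ ∧ ∃ reg : QCDRegularisation Nf, reg.HasMassScaling ∧
        ∀ m : Fin Nf → ℝ, (∀ f, M₀ < m f) →
          ∃ (z shift : QCDField Nf → ℕ → ℝ) (T : OSData (QCDField Nf) 4),
            IsQCDAlong (reg.scheme m z shift) T ∧ T.IsNontrivial QCDField.glue ∧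
              T.IsNonGaussian QCDField.glue ∧
                ∀ f g : Fin Nf, f ≠ g → T.IsNontrivial (QCDField.pseudoRe f g) :=
  fun hT => not_continuumQCDExists_of_not_interleavedFlowProper h
    (RobustYangMillsHandover.Negative.continuumQCDExists_iff_threshold.mpr hT)

end Summit.QuantumFields.QCD.Theorems.InterleavedFlowProper.Negative
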